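import Literature.MathematicalPhysics.StatisticalMechanics.LocalLimitOfGroundStates
import Literature.MathematicalPhysics.StatisticalMechanics.LocalMatchingCompactness

/-!
# Route `GscTwinLoopSurgery`, support item `GscHingeGlue` (stmt-AtomisticToContinuum-14087): matching toolkit

Elementary lemmas on the two-way matching predicate `BallMatch δ R c A S` of
`MuGroundStateConfiguration.lean` ("every point of `S` in the ball `B(c, R)` has a point of `A`
within `δ`, and conversely"), used throughout the proof of the glue `GscHingeGlue`
(compactness / local-limit transport of windows):

* `ballMatch_recentre` — a matching on `B(c, R)` restricts to every ball `B(c', R')` inside it;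
* `ballMatch_image_of_isometry` — matchings are transported by distance-preserving maps;
* `ballMatch_of_ballMatch_of_near` — a window of `Y` (matching with a pattern `S` on a ball about
  `c`) is a window of every `X'` that is two-way `ε'`-matched with `Y` on a large ball about a
  base point `o` (tolerance `δ + ε'`, radius shrinks by `ε'`);
* `exists_ballMatch_based_of_near` — the same for BASED windows `(fun s ↦ y + A (s - q)) '' Q`
  at a point `y ∈ Y`: the approximant `X'` has a point `x` within `ε'` of `y` carrying the
  window re-based at `x` (tolerance `δ + 2ε'`, radius shrinks by `2ε'`);
* `ballMatch_based_image_affine` — based windows under affine isometries `x ↦ L x + w`;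
* `ballMatch_range_based_iff` — a based window of a finite configuration `range x` at the
  particle `x i` is literally the "good particle" clause of `GroundStatesChargePeriodic`;
* `exists_le_of_forall_pos_exists_le_add` — closure lemma for finite candidate sets.

All `[folklore]`; nothing here closes an item.
-/

noncomputable section

open scoped BigOperators Topology
open Filter Set Metric

namespace Summit.AtomisticToContinuum.Crystallization.Theorems

open Literature.MathematicalPhysics.StatisticalMechanics

section PseudoMetric

variable {α β : Type*} [PseudoMetricSpace α] [PseudoMetricSpace β]
variable {δ ε' R R' : ℝ} {c c' o : α} {A S X' Y : Set α}

/-- A two-way matching on the ball `B(c, R)` restricts to every ball `B(c', R')` contained in it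
(`dist c' c + R' ≤ R`). [folklore] -/
theorem ballMatch_recentre (h : BallMatch δ R c A S) (hR : dist c' c + R' ≤ R) :
    BallMatch δ R' c' A S := by
  refine ⟨fun s hs hsc => h.1 s hs ?_, fun a ha hac => h.2 a ha ?_⟩
  · calc dist s c ≤ dist s c' + dist c' c := dist_triangle _ _ _
      _ ≤ R := by linarith
  · calc dist a c ≤ dist a c' + dist c' c := dist_triangle _ _ _
      _ ≤ R := by linarith

/-- Two-way matchings are transported by distance-preserving maps. [folklore] -/
theorem ballMatch_image_of_isometry {f : α → β} (hf : Isometry f) (h : BallMatch δ R c A S) :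
    BallMatch δ R (f c) (f '' A) (f '' S) := by
  refine ⟨?_, ?_⟩
  · rintro _ ⟨s, hs, rfl⟩ hsc
    rw [hf.dist_eq] at hsc
    obtain ⟨a, ha, has⟩ := h.1 s hs hsc
    exact ⟨f a, mem_image_of_mem f ha, by rw [hf.dist_eq]; exact has⟩
  · rintro _ ⟨a, ha, rfl⟩ hac
    rw [hf.dist_eq] at hac
    obtain ⟨s, hs, has⟩ := h.2 a ha hac
    exact ⟨f s, mem_image_of_mem f hs, by rw [hf.dist_eq]; exact has⟩

/-- **Windows pass to nearby configurations.** If `Y` and the pattern `S` are two-way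
`δ`-matched on the ball of radius `R + ε'` about `c`, and `X'`, `Y` are two-way `ε'`-matched on
the ball of radius `R' ≥ dist c o + R + δ` about `o`, then `X'` and `S` are two-way
`(δ + ε')`-matched on the ball of radius `R` about `c`. [folklore] -/
theorem ballMatch_of_ballMatch_of_near (hwin : BallMatch δ (R + ε') c Y S)
    (hlim : BallMatch ε' R' o X' Y) (hδ : 0 ≤ δ) (hε' : 0 ≤ ε')
    (hR' : dist c o + R + δ ≤ R') : BallMatch (δ + ε') R c X' S := by
  refine ⟨fun s hs hsc => ?_, fun x hx hxc => ?_⟩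
  · obtain ⟨y, hy, hys⟩ := hwin.1 s hs (by linarith)
    have hyo : dist y o ≤ R' :=
      calc dist y o ≤ dist y s + dist s c + dist c o := dist_triangle4 _ _ _ _
        _ ≤ R' := by linarith
    obtain ⟨x, hx, hxy⟩ := hlim.1 y hy hyo
    refine ⟨x, hx, ?_⟩
    calc dist x s ≤ dist x y + dist y s := dist_triangle _ _ _
      _ ≤ ε' + δ := add_le_add hxy hys
      _ = δ + ε' := add_comm _ _
  · have hxo : dist x o ≤ R' :=
      calc dist x o ≤ dist x c + dist c o := dist_triangle _ _ _
        _ ≤ R' := by linarith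
    obtain ⟨y, hy, hxy⟩ := hlim.2 x hx hxo
    have hyc : dist y c ≤ R + ε' :=
      calc dist y c ≤ dist y x + dist x c := dist_triangle _ _ _
        _ ≤ ε' + R := add_le_add (by rwa [dist_comm]) hxc
        _ = R + ε' := add_comm _ _
    obtain ⟨s, hs, hys⟩ := hwin.2 y hy hyc
    refine ⟨s, hs, ?_⟩
    calc dist x s ≤ dist x y + dist y s := dist_triangle _ _ _
      _ ≤ ε' + δ := add_le_add hxy hys
      _ = δ + ε' := add_comm _ _

/-- **Closure lemma for finite candidate sets**: if for every `η > 0` some member `p` of the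
finite set `F` has `g p ≤ r + η`, then some member has `g p ≤ r`. [folklore] -/
theorem exists_le_of_forall_pos_exists_le_add {ι : Type*} {F : Set ι} (hF : F.Finite)
    {g : ι → ℝ} {r : ℝ} (h : ∀ η : ℝ, 0 < η → ∃ p ∈ F, g p ≤ r + η) : ∃ p ∈ F, g p ≤ r := by
  by_contra hcon
  push Not at hcon
  obtain ⟨p₁, hp₁, -⟩ := h 1 one_pos
  have hne : hF.toFinset.Nonempty := ⟨p₁, hF.mem_toFinset.2 hp₁⟩
  set m : ℝ := hF.toFinset.inf' hne g with hm
  have hmr : r < m := by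
    rw [hm, Finset.lt_inf'_iff]
    intro p hp
    exact hcon p (hF.mem_toFinset.1 hp)
  obtain ⟨p, hp, hgp⟩ := h ((m - r) / 2) (by linarith)
  have hmp : m ≤ g p := Finset.inf'_le g (hF.mem_toFinset.2 hp)
  linarith

end PseudoMetric

section Normed

variable {E : Type*} [NormedAddCommGroup E] [NormedSpace ℝ E]
variable {δ ε' R R' : ℝ}

/-- **Based windows pass to nearby configurations.** Let `y ∈ Y` carry a based window: `Y` and
the pattern `(fun s ↦ y + A (s - q)) '' Q` are two-way `δ`-matched on the ball of radius
`R + 2ε'` about `y`. If `X'` and `Y` are two-way `ε'`-matched on the ball of radius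
`R' ≥ dist y o + R + δ + 3ε'` about `o`, then `X'` has a point `x` within `ε'` of `y` such that
`X'` and the re-based pattern `(fun s ↦ x + A (s - q)) '' Q` are two-way `(δ + 2ε')`-matched on
the ball of radius `R` about `x`. [folklore] -/
theorem exists_ballMatch_based_of_near {X' Y Q : Set E} {y o : E} {A : E →ₗᵢ[ℝ] E} {q : E}
    (hy : y ∈ Y) (hwin : BallMatch δ (R + 2 * ε') y Y ((fun s => y + A (s - q)) '' Q))
    (hlim : BallMatch ε' R' o X' Y) (hR : 0 ≤ R) (hδ : 0 ≤ δ) (hε' : 0 ≤ ε')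
    (hR' : dist y o + R + δ + 3 * ε' ≤ R') :
    ∃ x ∈ X', dist x y ≤ ε' ∧ BallMatch (δ + 2 * ε') R x X' ((fun s => x + A (s - q)) '' Q) := by
  obtain ⟨x, hx, hxy⟩ := hlim.1 y hy (by linarith)
  refine ⟨x, hx, hxy, ?_, ?_⟩
  · rintro _ ⟨s, hs, rfl⟩ hsc
    have hsc' : dist (y + A (s - q)) y ≤ R + 2 * ε' := by
      have h1 : dist (y + A (s - q)) y = dist (x + A (s - q)) x := by simp [dist_eq_norm]
      rw [h1]; linarith
    obtain ⟨y', hy', hys⟩ := hwin.1 _ (mem_image_of_mem _ hs) hsc'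
    have hy'o : dist y' o ≤ R' :=
      calc dist y' o ≤ dist y' (y + A (s - q)) + dist (y + A (s - q)) y + dist y o :=
            dist_triangle4 _ _ _ _
        _ ≤ δ + (R + 2 * ε') + dist y o := by gcongr
        _ ≤ R' := by linarith
    obtain ⟨x', hx', hx'y'⟩ := hlim.1 y' hy' hy'o
    refine ⟨x', hx', ?_⟩
    have h2 : dist (y + A (s - q)) (x + A (s - q)) = dist y x := by simp [dist_eq_norm]
    calc dist x' (x + A (s - q))
        ≤ dist x' y' + dist y' (y + A (s - q)) + dist (y + A (s - q)) (x + A (s - q)) :=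
          dist_triangle4 _ _ _ _
      _ ≤ ε' + δ + ε' := by rw [h2, dist_comm y x]; gcongr
      _ = δ + 2 * ε' := by ring
  · intro x' hx' hx'x
    have hx'o : dist x' o ≤ R' :=
      calc dist x' o ≤ dist x' x + dist x y + dist y o := dist_triangle4 _ _ _ _
        _ ≤ R + ε' + dist y o := by gcongr
        _ ≤ R' := by linarith
    obtain ⟨y', hy', hx'y'⟩ := hlim.2 x' hx' hx'o
    have hy'y : dist y' y ≤ R + 2 * ε' :=
      calc dist y' y ≤ dist y' x' + dist x' x + dist x y := dist_triangle4 _ _ _ _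
        _ ≤ ε' + R + ε' := by rw [dist_comm y' x']; gcongr
        _ = R + 2 * ε' := by ring
    obtain ⟨_, ⟨s, hs, rfl⟩, hy's⟩ := hwin.2 y' hy' hy'y
    refine ⟨x + A (s - q), mem_image_of_mem _ hs, ?_⟩
    have h2 : dist (y + A (s - q)) (x + A (s - q)) = dist y x := by simp [dist_eq_norm]
    calc dist x' (x + A (s - q))
        ≤ dist x' y' + dist y' (y + A (s - q)) + dist (y + A (s - q)) (x + A (s - q)) :=
          dist_triangle4 _ _ _ _
      _ ≤ ε' + δ + ε' := by rw [h2, dist_comm y x]; gcongr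
      _ = δ + 2 * ε' := by ring

/-- The affine map `x ↦ L x + w` of a linear isometry `L` is an isometry. [folklore] -/
theorem isometry_linearIsometry_add (L : E →ₗᵢ[ℝ] E) (w : E) :
    Isometry (fun x => L x + w) :=
  Isometry.of_dist_eq fun x y => by rw [dist_add_right, L.dist_map]

/-- **Based windows under affine isometries.** If `X` and `(fun s ↦ p + A (s - q)) '' Q` are
two-way `δ`-matched on `B(p, R)`, then the image `(fun x ↦ L x + w) '' X` and the pattern based
at `L p + w` with the composed isometry `L ∘ A` are two-way `δ`-matched on `B(L p + w, R)`.
[folklore] -/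
theorem ballMatch_based_image_affine {X Q : Set E} {p q : E} {A : E →ₗᵢ[ℝ] E}
    (L : E →ₗᵢ[ℝ] E) (w : E) (h : BallMatch δ R p X ((fun s => p + A (s - q)) '' Q)) :
    BallMatch δ R (L p + w) ((fun x => L x + w) '' X)
      ((fun s => (L p + w) + (L.comp A) (s - q)) '' Q) := by
  have h1 := ballMatch_image_of_isometry (isometry_linearIsometry_add L w) h
  have h2 : (fun x => L x + w) '' ((fun s => p + A (s - q)) '' Q) =
      (fun s => (L p + w) + (L.comp A) (s - q)) '' Q := by
    rw [Set.image_image]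
    refine Set.image_congr fun s _ => ?_
    simp only [map_add, LinearIsometry.coe_comp, Function.comp_apply]
    abel
  rw [h2] at h1
  exact h1

/-- A based window of the finite configuration `range x` at the particle `x i` is literally the
"good particle" clause of `GroundStatesChargePeriodic` (pattern `Q`, isometry `A`, base point
`q`). [folklore] -/
theorem ballMatch_range_based_iff {N : ℕ} (x : Fin N → E) (i : Fin N) (A : E →ₗᵢ[ℝ] E)
    (q : E) (Q : Set E) (ε R : ℝ) :
    BallMatch ε R (x i) (Set.range x) ((fun s => x i + A (s - q)) '' Q) ↔
      (∀ s ∈ Q, dist s q ≤ R → ∃ j, dist (x j) (x i + A (s - q)) ≤ ε) ∧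
        (∀ j, dist (x j) (x i) ≤ R → ∃ s ∈ Q, dist (x j) (x i + A (s - q)) ≤ ε) := by
  have hd : ∀ s, dist (x i + A (s - q)) (x i) = dist s q := fun s => by
    rw [dist_eq_norm, add_sub_cancel_left, A.norm_map, ← dist_eq_norm]
  simp only [BallMatch, Set.forall_mem_image, Set.exists_mem_image, Set.forall_mem_range,
    Set.exists_range_iff, hd]

end Normed

end Summit.AtomisticToContinuum.Crystallization.Theorems

end
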